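import Summits.NavierStokesRegularity.NavierStokesRegularity.Theorems.UnthreadedDoorIndicatrixAnalyticFrameOfAnalyticData
import Summits.NavierStokesRegularity.NavierStokesRegularity.Theorems.UnthreadedDoorIndicatrixAnalyticCellFiniteness
import HarnessLib

/-!
# Route `UnthreadedDoor`, crux `PoloidalLiouville` (stmt-NavierStokesRegularity-1222), WALL W1 — crux idea «cell-flux» (ns-idea-14):
# Σ-5 `stub_cellTame_of_branches` MODULO the named fact F1 — gauge rigidity + zonal branch + K3^Σ-analytic ⇒ K3^Σ

Support file (theorems only; `--supports stmt-NavierStokesRegularity-1222 --as helper`).  The registered stub Σ-5 of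
`Cruxes/PoloidalLiouville/CellFluxSketch.lean` (v1.2.15 l.976) is `UnthreadedGaugeRigidity → ZonalTypeIScalarLiouville → CellTameAnalyticScalarLiouvilleTypeI →
CellTameScalarLiouvilleTypeI`.  Its analytic branch needs two things the stub's antecedents do not carry: (α) a JOINTLY real-analytic representative of
the potential off the centre line — the radial gauge `T̃ t x = T t x − T t (x₀ + ‖x − x₀‖ • σ₀)` of `Indicatrix.analyticOnNhd_radialGauge_uncurry` (ARM A g8,
p729846) — and (β) cell-finiteness of ANALYTIC slices, which in the tree is Λ-geo `Indicatrix.analyticCellFiniteness_of` (p727975) FROM the named fact F1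
(Bierstone–Milman Cor. 2.7 (2); a theorem modulo «`ℝ_an,exp` is o-minimal», p710694).  This file proves the stub WITH THE F1 BODY PREPENDED:
★ `cellTame_of_branches_of_signSetFinite : <F1 body> → UnthreadedGaugeRigidity → ZonalTypeIScalarLiouville → CellTameAnalyticScalarLiouvilleTypeI →
CellTameScalarLiouvilleTypeI` (+ `_of_realAnExp hO`).  Ingredients: `sphCrit (T̃ t) x₀ r = sphCrit (T t) x₀ r` (the cross field `∇(·) × (x − x₀)` is
gauge-invariant, also at `x₀`), hence `cellSet` / `isoCrit` are unchanged and hypothesis 9 (the `N₀, D, B` counts) transfers verbatim; the K3^Σ-analytic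
binders for `(v, T̃)` are re-established as in `Indicatrix.analyticFrame_of_analyticData` (p730290).  The custodian may re-type Σ-5 with the F1 antecedent
(as Λ-geo) or wire it under an `hO` binder.  HONEST: a reduction; Σ-1, Σ-2, Σ-0bR₂ (behind K3^Σ-analytic) and F1's standing fact stay OPEN; ⟨1222⟩, W1 and NS
regularity OPEN.  ARM A `pub/ns-exp-scalarLiouville` g8.
-/

noncomputable section

-- the summit and its single sub-problem share the name (CONVENTIONS §1)
set_option linter.dupNamespace false

open Set Function Filter Topology InnerProductSpace MeasureTheory Metric
open scoped RealInnerProductSpace ContDiff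

namespace Summit.NavierStokesRegularity.NavierStokesRegularity.Theorems.PoloidalLiouville.CellFlux

open Summit.NavierStokesRegularity.NavierStokesRegularity.Theorems.PoloidalLiouville.NetFlux
  (E3 CurledLaw curledLawRadialGauge)
open Summit.NavierStokesRegularity.NavierStokesRegularity.Theorems.PoloidalLiouville.Indicatrix
  (analyticOnNhd_radialGauge_uncurry analyticCellFiniteness_of cross_gradient_radialGauge)
open Literature.Analysis Literature.Analysis.FluidPDE

variable {x₀ σ₀ : E3}

/-! ### The radial gauge does not change the cell objects -/

/-- If two potentials have the same cross field `∇(·)(x) × (x − x₀)` at every `x ≠ x₀`, they have the same sphere-critical sets (at `x₀` both fields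
vanish). [folklore] -/
theorem sphCrit_congr {f g : E3 → ℝ} (h : ∀ x, x ≠ x₀ → cross (gradient f x) (x - x₀) = cross (gradient g x) (x - x₀)) (r : ℝ) :
    sphCrit f x₀ r = sphCrit g x₀ r := by
  have h' : ∀ x, cross (gradient f x) (x - x₀) = cross (gradient g x) (x - x₀) := by
    intro x
    by_cases hx : x = x₀
    · rw [hx, sub_self, NetFlux.cross_zero_right, NetFlux.cross_zero_right]
    · exact h x hx
  ext x
  simp only [sphCrit, mem_setOf_eq, h' x]

/-- Same cross field off the centre ⇒ same cells. [folklore] -/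
theorem cellSet_congr {f g : E3 → ℝ} (h : ∀ x, x ≠ x₀ → cross (gradient f x) (x - x₀) = cross (gradient g x) (x - x₀)) (r : ℝ) :
    cellSet f x₀ r = cellSet g x₀ r := by
  unfold cellSet cellOf sheetTrace
  rw [sphCrit_congr h r]

/-- Same cross field off the centre ⇒ same isolated critical points. [folklore] -/
theorem isoCrit_congr {f g : E3 → ℝ} (h : ∀ x, x ≠ x₀ → cross (gradient f x) (x - x₀) = cross (gradient g x) (x - x₀)) (r : ℝ) :
    isoCrit f x₀ r = isoCrit g x₀ r := by
  unfold isoCrit sheetTrace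
  rw [sphCrit_congr h r]

/-! ### The radial gauge keeps every K3 binder (space-time versions of the steps of `Indicatrix.analyticFrame_of_analyticData`) -/

/-- The ray point stays off the centre. [folklore] -/
theorem rayPoint_ne (hσ₀ : σ₀ ≠ 0) {x : E3} (hx : x ≠ x₀) : x₀ + ‖x - x₀‖ • σ₀ ≠ x₀ := by
  intro h
  rw [add_eq_left, smul_eq_zero] at h
  rcases h with h | h
  · exact hx (sub_eq_zero.1 (norm_eq_zero.1 h))
  · exact hσ₀ h

/-- Smoothness of the radial gauge on the slab off the centre line. [folklore] -/
theorem contDiffOn_radialGauge (hσ₀ : σ₀ ≠ 0) {T : ℝ → E3 → ℝ} {𝒯 : Set ℝ}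
    (hT : ContDiffOn ℝ (⊤ : ℕ∞) (uncurry T) (𝒯 ×ˢ ({x₀}ᶜ : Set E3))) :
    ContDiffOn ℝ (⊤ : ℕ∞) (uncurry fun t x => T t x - T t (x₀ + ‖x - x₀‖ • σ₀)) (𝒯 ×ˢ ({x₀}ᶜ : Set E3)) := by
  have hrayC : ContDiffOn ℝ (⊤ : ℕ∞) (fun p : ℝ × E3 => ((p.1, x₀ + ‖p.2 - x₀‖ • σ₀) : ℝ × E3)) (𝒯 ×ˢ ({x₀}ᶜ : Set E3)) := by
    intro p hp
    have hp2 : p.2 - x₀ ≠ 0 := sub_ne_zero.2 hp.2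
    exact (contDiffAt_fst.prodMk (contDiffAt_const.add
      (((contDiffAt_snd.sub contDiffAt_const).norm ℝ hp2).smul contDiffAt_const))).contDiffWithinAt
  have hrayM : MapsTo (fun p : ℝ × E3 => ((p.1, x₀ + ‖p.2 - x₀‖ • σ₀) : ℝ × E3)) (𝒯 ×ˢ ({x₀}ᶜ : Set E3)) (𝒯 ×ˢ ({x₀}ᶜ : Set E3)) :=
    fun p hp => ⟨hp.1, rayPoint_ne hσ₀ hp.2⟩
  refine (hT.sub (hT.comp hrayC hrayM)).congr fun p _ => ?_
  simp only [uncurry, comp_apply]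

/-- Slice differentiability of a potential smooth on the slab off the centre line. [folklore] -/
theorem differentiableAt_slice {T : ℝ → E3 → ℝ} {𝒯 : Set ℝ} (hT : ContDiffOn ℝ (⊤ : ℕ∞) (uncurry T) (𝒯 ×ˢ ({x₀}ᶜ : Set E3)))
    {t : ℝ} (ht : t ∈ 𝒯) {x : E3} (hx : x ≠ x₀) : DifferentiableAt ℝ (T t) x := by
  have h1 : ContDiffOn ℝ (⊤ : ℕ∞) (uncurry T ∘ fun z : E3 => (t, z)) ({x₀}ᶜ : Set E3) :=
    hT.comp (contDiff_prodMk_right t).contDiffOn fun z hz => ⟨ht, hz⟩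
  exact (h1.differentiableOn (by simp) x hx).differentiableAt (isOpen_compl_singleton.mem_nhds hx)

/-- The radial gauge has the same cross field off the centre. [folklore] -/
theorem cross_gradient_radialGauge_slice (hσ₀ : σ₀ ≠ 0) {T : ℝ → E3 → ℝ} {𝒯 : Set ℝ}
    (hT : ContDiffOn ℝ (⊤ : ℕ∞) (uncurry T) (𝒯 ×ˢ ({x₀}ᶜ : Set E3))) {t : ℝ} (ht : t ∈ 𝒯) (x : E3) (hx : x ≠ x₀) :
    cross (gradient ((fun t x => T t x - T t (x₀ + ‖x - x₀‖ • σ₀)) t) x) (x - x₀) = cross (gradient (T t) x) (x - x₀) :=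
  cross_gradient_radialGauge hx (differentiableAt_slice hT ht hx) (differentiableAt_slice hT ht (rayPoint_ne hσ₀ hx))

/-- The link is gauge-invariant (also at the centre, where both sides vanish). [folklore] -/
theorem link_radialGauge (hσ₀ : σ₀ ≠ 0) {v : ℝ → E3 → E3} {T : ℝ → E3 → ℝ}
    (hT : ContDiffOn ℝ (⊤ : ℕ∞) (uncurry T) (Iio 0 ×ˢ ({x₀}ᶜ : Set E3)))
    (hlink : ∀ t < 0, ∀ x, curl (v t) x = cross (gradient (T t) x) (x - x₀)) :
    ∀ t < 0, ∀ x, curl (v t) x = cross (gradient ((fun t x => T t x - T t (x₀ + ‖x - x₀‖ • σ₀)) t) x) (x - x₀) := by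
  intro t ht x
  by_cases hx : x = x₀
  · rw [hx, sub_self, NetFlux.cross_zero_right, hlink t ht, sub_self, NetFlux.cross_zero_right]
  · rw [cross_gradient_radialGauge_slice hσ₀ hT ht x hx, hlink t ht]

/-- The curled law is gauge-covariant under the radial gauge (`NetFlux.curledLawRadialGauge` with `c t r = −T t (x₀ + r • σ₀)`). [folklore] -/
theorem curledLaw_radialGauge (hσ₀ : σ₀ ≠ 0) {v : ℝ → E3 → E3} {T : ℝ → E3 → ℝ}
    (hv : ContDiffOn ℝ (⊤ : ℕ∞) (uncurry v) (Iio 0 ×ˢ (univ : Set E3)))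
    (hT : ContDiffOn ℝ (⊤ : ℕ∞) (uncurry T) (Iio 0 ×ˢ ({x₀}ᶜ : Set E3))) (hlaw : CurledLaw v x₀ T (Iio 0)) :
    CurledLaw v x₀ (fun t x => T t x - T t (x₀ + ‖x - x₀‖ • σ₀)) (Iio 0) := by
  have hc : ContDiffOn ℝ (⊤ : ℕ∞) (uncurry fun t r => -T t (x₀ + r • σ₀)) (Iio 0 ×ˢ Ioi (0 : ℝ)) := by
    have h1 : ContDiffOn ℝ (⊤ : ℕ∞) (fun p : ℝ × ℝ => ((p.1, x₀ + p.2 • σ₀) : ℝ × E3)) (Iio 0 ×ˢ Ioi (0 : ℝ)) := by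
      fun_prop
    have h2 : MapsTo (fun p : ℝ × ℝ => ((p.1, x₀ + p.2 • σ₀) : ℝ × E3)) (Iio 0 ×ˢ Ioi (0 : ℝ))
        (Iio 0 ×ˢ ({x₀}ᶜ : Set E3)) := by
      intro p hp
      refine ⟨hp.1, ?_⟩
      show x₀ + p.2 • σ₀ ∈ ({x₀}ᶜ : Set E3)
      rw [mem_compl_singleton_iff, ne_eq, add_eq_left, smul_eq_zero, not_or]
      exact ⟨ne_of_gt hp.2, hσ₀⟩
    refine ((hT.comp h1 h2).neg).congr fun p _ => ?_
    simp only [uncurry, comp_apply]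
  have h := curledLawRadialGauge v x₀ T (fun t r => -T t (x₀ + r • σ₀)) (Iio 0) isOpen_Iio hv hT hc hlaw
  have hfun : (fun t x => T t x + (fun t r => -T t (x₀ + r • σ₀)) t ‖x - x₀‖) =
      fun t x => T t x - T t (x₀ + ‖x - x₀‖ • σ₀) := by
    funext t x
    ring
  rw [hfun] at h
  exact h

/-! ### Σ-5 modulo F1 -/

/-- ★ **Σ-5 MODULO F1: `<F1 body> → UnthreadedGaugeRigidity → ZonalTypeIScalarLiouville → CellTameAnalyticScalarLiouvilleTypeI →
CellTameScalarLiouvilleTypeI`** (the three CellFlux Props by name from the Defs twin p692073; F1 = the body of `BierstoneMilman1988_signSet_components_finite`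
of `Cruxes/PoloidalLiouville/IndicatrixSketch.lean` §F VERBATIM). [folklore] -/
theorem cellTame_of_branches_of_signSetFinite
    (hF1 : ∀ (E : Type) [NormedAddCommGroup E] [NormedSpace ℝ E] [FiniteDimensional ℝ E] (U : Set E) (h g : E → ℝ),
      IsOpen U → AnalyticOnNhd ℝ h U → AnalyticOnNhd ℝ g U → IsCompact {x | x ∈ U ∧ h x = 0} →
        (connectedComponentIn {x | x ∈ U ∧ h x = 0 ∧ g x = 0} '' {x | x ∈ U ∧ h x = 0 ∧ g x = 0}).Finite ∧
        (connectedComponentIn {x | x ∈ U ∧ h x = 0 ∧ g x ≠ 0} '' {x | x ∈ U ∧ h x = 0 ∧ g x ≠ 0}).Finite)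
    (h₁ : UnthreadedGaugeRigidity) (h₂ : ZonalTypeIScalarLiouville) (h₃ : CellTameAnalyticScalarLiouvilleTypeI) :
    CellTameScalarLiouvilleTypeI := by
  intro v x₀ T hC hB hm hsv hsT hTb hrep hE h9
  rcases h₁ v x₀ T hB hm hsv hrep with hA | hZ
  swap
  · exact h₂ v x₀ T hC hB hm hsv hsT hTb hrep hE hZ
  -- the analytic branch: re-gauge radially and run K3^Σ-analytic on `(v, T̃)`
  obtain ⟨N₀, D, hDc, hD0, hcount⟩ := h9
  set σ₀ : E3 := EuclideanSpace.single 0 1 with hσ₀def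
  have hσ₀ : ‖σ₀‖ = 1 := by simp [hσ₀def]
  have hσ₀ne : σ₀ ≠ 0 := fun h => by rw [h, norm_zero] at hσ₀; exact zero_ne_one hσ₀
  set T' : ℝ → E3 → ℝ := fun t x => T t x - T t (x₀ + ‖x - x₀‖ • σ₀) with hT'
  have hsT' : ContDiffOn ℝ (⊤ : ℕ∞) (uncurry T') (Iio 0 ×ˢ ({x₀}ᶜ : Set E3)) := contDiffOn_radialGauge hσ₀ne hsT
  obtain ⟨C, hCb⟩ := hTb
  have hT'b : ∃ C' : ℝ, ∀ t < 0, ∀ x, |T' t x| ≤ C' :=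
    ⟨C + C, fun t ht x => (abs_sub _ _).trans (add_le_add (hCb t ht x) (hCb t ht _))⟩
  have hrep' : ∀ t < 0, ∀ x, curl (v t) x = cross (gradient (T' t) x) (x - x₀) := link_radialGauge hσ₀ne hsT hrep
  have hE' : CurledLaw v x₀ T' (Iio 0) := curledLaw_radialGauge hσ₀ne hsv hsT hE
  have hT'a : AnalyticOnNhd ℝ (uncurry T') (Iio 0 ×ˢ ({x₀}ᶜ : Set E3)) :=
    analyticOnNhd_radialGauge_uncurry isOpen_Iio hσ₀ hA hsT (fun t ht => hrep t ht)
  -- the cell objects of `T̃ t` and `T t` coincide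
  have hcross : ∀ t < 0, ∀ x, x ≠ x₀ → cross (gradient (T' t) x) (x - x₀) = cross (gradient (T t) x) (x - x₀) :=
    fun t ht x hx => cross_gradient_radialGauge_slice hσ₀ne hsT ht x hx
  have hcell : ∀ t < 0, ∀ r, cellSet (T' t) x₀ r = cellSet (T t) x₀ r := fun t ht r => cellSet_congr (hcross t ht) r
  -- slices are analytic
  have hvt : ∀ t < 0, AnalyticOnNhd ℝ (v t) (univ : Set E3) := by
    intro t ht x _
    have h1 : AnalyticAt ℝ (uncurry v) (t, x) := hA (t, x) ⟨ht, mem_univ _⟩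
    have h2 : AnalyticAt ℝ (fun z : E3 => ((t, z) : ℝ × E3)) x :=
      (contDiffAt_const.prodMk contDiffAt_id).analyticAt
    exact h1.comp h2
  have hT't : ∀ t < 0, AnalyticOnNhd ℝ (T' t) ({x₀}ᶜ : Set E3) := by
    intro t ht x hx
    have h1 : AnalyticAt ℝ (uncurry T') (t, x) := hT'a (t, x) ⟨ht, hx⟩
    have h2 : AnalyticAt ℝ (fun z : E3 => ((t, z) : ℝ × E3)) x :=
      (contDiffAt_const.prodMk contDiffAt_id).analyticAt
    exact h1.comp h2
  -- the stratum predicate for `(v, T̃)`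
  have hpred : ∀ t < 0, cellPred N₀ D v x₀ T' t := by
    intro t ht
    have hfin : cellFinitePred v x₀ T' t :=
      ⟨hvt t ht, hT't t ht, fun r hr => analyticCellFiniteness_of hF1 x₀ (T' t) r hr (hT't t ht)⟩
    refine ⟨hfin, fun htD => ⟨hfin, ?_⟩⟩
    obtain ⟨B, hBc, hB0, hB⟩ := hcount t ht htD
    refine ⟨B, hBc, hB0, fun r hr hrB => ?_⟩
    rw [hcell t ht r]
    exact (hB r hr hrB).2
  have key := h₃ N₀ D hDc hD0 v x₀ T' hC hB hm hsv hsT' hT'b hrep' hE' hA hT'a hpred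
  intro t ht x
  rw [← hrep t ht x, hrep' t ht x]
  exact key t ht x

/-- ★ **Σ-5 BY NAME modulo the one standing fact «`ℝ_an,exp` is o-minimal»** (F1 = p710694 by name). [folklore] -/
theorem cellTame_of_branches_of_realAnExp
    (hO : Literature.ModelTheory.ExponentialFields.VandendriesMiller1994_realAnExp_isOMinimal) :
    UnthreadedGaugeRigidity → ZonalTypeIScalarLiouville → CellTameAnalyticScalarLiouvilleTypeI → CellTameScalarLiouvilleTypeI :=
  cellTame_of_branches_of_signSetFinite
    (Literature.Analysis.Calculus.analyticSignSet_connectedComponents_finite_of_realAnExp_isOMinimal hO)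

end Summit.NavierStokesRegularity.NavierStokesRegularity.Theorems.PoloidalLiouville.CellFlux

end
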